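import Literature.NumberTheory.LFunctions.Zhang2022.RepairTopFormIndefinite

/-!
# Zhang (2022), rung F-S2 (cell zhang-knife), obstruction annex to F-S1R: the two-piece overhang design —
# RANK-ONE tail coupling (proved) and the INVISIBLE-OVERHANG null (proved logic)

Y. Zhang, *Discrete mean estimates and the Landau–Siegel zero*, arXiv:2211.02515v1 [Zhang2022LandauSiegel] —
an unrefereed manuscript under adjudication. **WHAT THIS IS NOT: not a claim about Theorems 1–2 of
arXiv:2211.02515, about Landau–Siegel zeros, or about Parity; nothing here asserts any claim of the manuscript.**
Frontier ideation (rung F-S2, lens barrier-inversion) about ONE analytic input of the manuscript's method, typed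
over the F-S1R kit `RepairTopFormIndefinite` (`Repair.MformTop`, `Repair.topDiagForm`, `Repair.gStar`, `Repair.phiT`,
`Repair.topForm_indefinite`, `Repair.MformTop_wit`); companion of `KnifeEdgeInvisibleTail` (Pólya–Vinogradov with
general weights — the engine behind the invisibility hypothesis of Part 8).

**Mechanism.** Inside the audited design class every main-order constant is a value of ONE positive-semidefinite
Hermitian form `𝔅 = mainTermForm` on `H¹[0,1]` (`MainTermFormCauchySchwarz.not_closing_of_isH1`,
`Repair.not_repairable_true_need`) and every piece has logarithmic length `≤ 1 = log P`
(`Repair.topDiagForm_re_nonneg_of_le_one`); for every `θ > 1` the continued formula I `M_θ = Repair.MformTop θ` is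
indefinite (`Repair.topForm_indefinite`, witness `s·g⋆ + φ_θ`). Split a profile of length `θ` as `u ⊕ v`: `u` an
in-class piece (support `[0,1]`, `InClassPiece`), `v` a pure overhang (support `[1,θ]`, `OverhangPiece`).
**Theorem (`rankOneTailCoupling_holds`, every `θ ≥ 1`):** `M_θ(u,v) = π·conj(Φ_v)·L(u)`, `M_θ(v,u) = 0`, with
`Φ_v = ∫₁^θ v` (`overhangMass`) and `L(u) = Σ_j W_jN_j[(u(1) − u(0)) + iπb_j∫₀¹u] = 12(u(1) − u(0)) + 24πi∫₀¹u`
(`tailFunctional`; `W = (½,2,3/2)`, `N = (6,3,2)`, `b = (1,2,3)`): the pieces see each other ONLY through the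
constant Dirichlet tail `π²N_j∫_y^θ v ≡ π²N_jΦ_v` on `[0,1]` — a rank-one pairing (overhang mass) ⊗ (tail
functional). The tree's witness is the instance `u = g⋆`, `v = φ_θ`: `L(g⋆) = 24`, `Φ = Repair.phiInt θ`,
`M_θ(g⋆,φ_θ) = 24πΦ` (Part 7, `MformTop_gStar_phiT` = the cross term of `Repair.MformTop_wit`). Whatever the
off-diagonal classes `n ≡ m (mod p)` contribute beyond `PT⁻²` — a pair functional `X`, the object open in print —
enters the would-be main constant `q_X(s) = |s|²𝔅(u) + 2Re[s(πΦ̄_vL(u) + X(u,v))] + Re 𝔅_θ(v) + 2Re X(v,v)`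
(`twoPieceMainTerm`); its positivity on every design (`Null`) forces, on kernel modes `𝔅(u) = 0`, the EXACT value
`X(u,v) = −π·conj(Φ_v)·L(u)` (`kernelModeCancellation_of_null`). **Part 8:** if the true `X` cancels the tail
coupling identically and nets the overhang block to zero (`InvisibleOverhang θ X` — the shape of the consequence of
complete character sums to modulus `pD = P^{1+o(1)}` for SMOOTH pieces supported beyond `P`), then
`q_X(s) = |s|²𝔅(u) ≥ 0` (`null_of_invisible`) and no smooth two-piece design closes by positivity
(`not_closes_of_invisible`).

**Contents** (Part numbers of the cell's Sketch `HOME/zhang-knife-barrier/Sketch.lean`, sha16 73303c3af639b98b;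
statements byte-identical to it modulo namespace): Part 1 objects; Part 2 the Prop `RankOneTailCoupling θ`; Part 3
the vocabulary `PairFunctional`, `twoPieceMainTerm`, `ClosesByPositivity`, `Null`, `KernelModeCancellation`,
`CompletedCS` (bare `Prop`s — NO claim that any holds) + the proved `cancellation_of_nonneg`,
`kernelModeCancellation_of_null`; Part 6 the proof for `θ ≥ 1`; Part 7 witness instances; Part 8 `InvisibleOverhang`
(bare `Prop`) + proved consequences. **Deliberately NOT here:** the candidates `TwoPieceBlockIdentity`,
`OverhangBlockPSD`, `EllSliverMass`, the error budgets `ErrorBudget` / `ErrorBudgetZ` / `PosWeightsZ` and their logic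
(Sketch Parts 3–5) — candidates of the cell's card, not facts. **Caveat:** `M_θ`, `θ > 1`, is formula I's calculus
continued, not a proved main term (as in `RepairTopFormIndefinite`).
References: Zhang, arXiv:2211.02515v1, §7 Prop 7.1, (7.2) p.44, §8 (8.11)–(8.12), Lemmas 8.2–8.4
[cite: Zhang2022LandauSiegel, §7 Prop 7.1 (7.2), §8]; invisibility engine / twisted moments to prime moduli:
H. M. Bui, K. Pratt, N. Robles, A. Zaharescu (2020) [BuiPrattRoblesZaharescu2020].
-/

noncomputable section

open Complex Real ComplexConjugate Set intervalIntegral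
open _root_.MeasureTheory

namespace Literature.NumberTheory.LFunctions.Zhang2022

namespace KnifeEdge

open Repair

/-! ### Part 1 — the two functionals through which mass beyond `P` talks to `[0,1]`, and the two kinds of piece -/

/-- The Dirichlet-tail functional of an in-class profile: `L(u) = Σ_j W_jN_j[(u(1) − u(0)) + iπb_j∫₀¹u]
= 12(u(1) − u(0)) + 24πi∫₀¹u` (`W = (1/2,2,3/2)`, `N = (6,3,2)`, `b = (1,2,3)`; `L(g⋆) = 24`).
[cite: Zhang2022LandauSiegel, Prop 7.1 p.44, (8.11)–(8.12)] -/
def tailFunctional (u : ℝ → ℂ) : ℂ := 12 * (u 1 - u 0) + 24 * (π : ℂ) * I * ∫ t in (0:ℝ)..1, u t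

/-- The mass of an overhang piece beyond `P`: `Φ_v = ∫₁^θ v` (for `φ_θ`: `Repair.phiInt θ = (θ−1)³/6`).
[cite: Zhang2022LandauSiegel, Prop 7.1 p.44, (7.2)] -/
def overhangMass (θ : ℝ) (v : ℝ → ℂ) : ℂ := ∫ t in (1:ℝ)..θ, v t

/-- An in-class one-sided piece presented on `[0, ∞)`: a kinked `H¹` profile on `[0,1]` (`Repair.KinkedProfile`)
vanishing, with its right derivative, on `[1, ∞)` (logarithmic length `≤ 1`, i.e. `n ≤ P`).
[cite: Zhang2022LandauSiegel, Prop 7.1 p.44, (7.2)] -/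
structure InClassPiece (u u' : ℝ → ℂ) : Prop where
  kinked : KinkedProfile u u'
  vanish : ∀ y, 1 ≤ y → u y = 0
  vanish' : ∀ y, 1 ≤ y → u' y = 0

/-- A pure overhang piece of logarithmic length `θ`: continuous on `[0,θ]`, identically `0` on `[0,1]`, a marked
right derivative on `[1,θ)`, vanishing at the top (`n ∈ [P, P^θ]`; e.g. `Repair.phiT θ`).
[cite: Zhang2022LandauSiegel, Prop 7.1 p.44, (7.2)] -/
structure OverhangPiece (θ : ℝ) (v v' : ℝ → ℂ) : Prop where
  cont : ContinuousOn v (Icc 0 θ)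
  hasDeriv : ∀ x ∈ Ico (1:ℝ) θ, HasDerivWithinAt v (v' x) (Ioi x) x
  /-- `v′ ∈ L²(1,θ)` (as `Repair.KinkedProfile.memLp` on `[0,1]`): keeps the overhang block `M_θ(v,v)` an honest
  integral (no junk value) and makes the translated piece `ṽ(x) = v(1+x)` a kinked profile for `θ ≤ 2`. -/
  memLp : MemLp v' 2 (volume.restrict (Ioc 1 θ))
  vanish : ∀ y, y ≤ 1 → v y = 0
  vanish' : ∀ y, y < 1 → v' y = 0
  top : v θ = 0

/-! ### Part 2 — the structural statement: in the continued formula I the coupling is rank one -/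

/-- **RANK-ONE TAIL COUPLING.** In the continued diagonal calculus `M_θ = Repair.MformTop θ` an in-class piece
`u` and an overhang piece `v` pair only through the tail term: `M_θ(u,v) = π·conj(Φ_v)·L(u)` and `M_θ(v,u) = 0`.
(Proved for every `θ ≥ 1` in Part 6: below `1` the `v`-slot of `Repair.dipoleIntegrandTop` is the constant
`π²N_jΦ̄_v`, above `1` the `u`-slot vanishes.) [cite: Zhang2022LandauSiegel, Prop 7.1 p.44, (8.11)–(8.12)] -/
def RankOneTailCoupling (θ : ℝ) : Prop :=
  ∀ u u' v v' : ℝ → ℂ, InClassPiece u u' → OverhangPiece θ v v' →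
    MformTop θ u u' v v' = (π : ℂ) * conj (overhangMass θ v) * tailFunctional u ∧ MformTop θ v v' u u' = 0

/-! ### Part 3 — statement vocabulary for the off-diagonal input (bare `Prop`s, none asserted) -/

/-- a main-order pair functional on profile pairs (shape of `Repair.MformTop θ`): the slot for the off-diagonal
main term of the classes `m ≡ n (mod p)`, absent for lengths `≤ P`. [cite: Zhang2022LandauSiegel, Prop 7.1 p.44, (7.2)] -/
abbrev PairFunctional : Type := (ℝ → ℂ) → (ℝ → ℂ) → (ℝ → ℂ) → (ℝ → ℂ) → ℂ

/-- **The two-piece main-term functional with off-diagonal input `X`:**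
`q_X(s) = |s|²·𝔅(u) + 2Re(s·(π·conj(Φ_v)·L(u) + X(u,v))) + Re 𝔅_θ(v) + 2Re X(v,v)` — the would-be constant of
`Σ𝔠*|s·H_u + H_v|²ω/(𝔞𝔓)` (in-class block `𝔅(u)`, cross block = tail coupling + `X(u,v)`, overhang block =
continued diagonal form + `X(v,v)`; `X = 0` is the continued calculus). [cite: Zhang2022LandauSiegel, Prop 7.1 p.44, (7.2)] -/
def twoPieceMainTerm (θ : ℝ) (X : PairFunctional) (u u' v v' : ℝ → ℂ) (s : ℂ) : ℝ :=
  ‖s‖ ^ 2 * mainTermForm u u'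
    + 2 * (s * ((π : ℂ) * conj (overhangMass θ v) * tailFunctional u + X u u' v v')).re
    + (topDiagForm θ v v').re + 2 * (X v v' v v').re

/-- **ESTIMATE shape (candidate, NOT asserted):** some two-piece design has a NEGATIVE main-order constant in the
`X`-world (`X = 0`: every `θ > 1`, `Repair.topForm_indefinite`). [cite: Zhang2022LandauSiegel, Prop 7.1 p.44, (7.2)] -/
def ClosesByPositivity (θ : ℝ) (X : PairFunctional) : Prop :=
  ∃ (u u' v v' : ℝ → ℂ) (s : ℂ), InClassPiece u u' ∧ OverhangPiece θ v v' ∧ twoPieceMainTerm θ X u u' v v' s < 0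

/-- **NULL shape (candidate, NOT asserted):** with the off-diagonal input `X` the two-piece constant is `≥ 0` on
every design — the completed form is again positive semidefinite. [cite: Zhang2022LandauSiegel, Prop 7.1 p.44, (7.2)] -/
def Null (θ : ℝ) (X : PairFunctional) : Prop :=
  ∀ (u u' v v' : ℝ → ℂ) (s : ℂ), InClassPiece u u' → OverhangPiece θ v v' → 0 ≤ twoPieceMainTerm θ X u u' v v' s

/-- **KERNEL-MODE CANCELLATION shape (candidate, NOT asserted):** for an in-class KERNEL MODE `u` (`𝔅(u) = 0`,
e.g. `g⋆`) and any overhang piece `v`, the off-diagonal cross main term cancels the tail coupling exactly: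
`X(u,v) = −π·conj(Φ_v)·L(u)` (`g⋆ ⊕ φ_θ`: `−24πΦ`). [cite: Zhang2022LandauSiegel, Prop 7.1 p.44, (7.2)] -/
def KernelModeCancellation (θ : ℝ) (X : PairFunctional) : Prop :=
  ∀ u u' v v' : ℝ → ℂ, InClassPiece u u' → OverhangPiece θ v v' → mainTermForm u u' = 0 →
    X u u' v v' = -((π : ℂ) * conj (overhangMass θ v) * tailFunctional u)

/-- **COMPLETED CAUCHY–SCHWARZ shape (candidate, NOT asserted):** the discriminant condition
`|πΦ̄_vL(u) + X(u,v)|² ≤ 𝔅(u)·(Re 𝔅_θ(v) + 2Re X(v,v))` (`KernelModeCancellation` is the case `𝔅(u) = 0`).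
[cite: Zhang2022LandauSiegel, Prop 7.1 p.44, (7.2)] -/
def CompletedCS (θ : ℝ) (X : PairFunctional) : Prop :=
  ∀ u u' v v' : ℝ → ℂ, InClassPiece u u' → OverhangPiece θ v v' →
    ‖(π : ℂ) * conj (overhangMass θ v) * tailFunctional u + X u u' v v'‖ ^ 2
      ≤ mainTermForm u u' * ((topDiagForm θ v v').re + 2 * (X v v' v v').re)

/-- The scalar lemma behind kernel-mode cancellation: a real quadratic `a|s|² + 2Re(s·c) + r ≥ 0` for all
complex `s` with `a = 0` has `c = 0` (private helper). [folklore] -/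
private theorem cancellation_of_nonneg {a r : ℝ} {c : ℂ} (h : ∀ s : ℂ, 0 ≤ a * ‖s‖ ^ 2 + 2 * (s * c).re + r)
    (ha : a = 0) : c = 0 := by
  by_contra hc
  have hcc : 0 < ‖c‖ ^ 2 := by positivity
  set t : ℝ := (r + 1) / (2 * ‖c‖ ^ 2) with ht
  have key := h (-(t : ℂ) * conj c)
  have hre : ((-(t : ℂ) * conj c) * c).re = -(t * ‖c‖ ^ 2) := by
    have : (-(t : ℂ) * conj c) * c = -((t : ℂ) * (conj c * c)) := by ring
    rw [this, Complex.conj_mul' c]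
    simp [← Complex.ofReal_pow, ← Complex.ofReal_mul]
  rw [ha, hre, ht] at key
  have : 2 * ((r + 1) / (2 * ‖c‖ ^ 2) * ‖c‖ ^ 2) = r + 1 := by field_simp
  linarith

/-- **NULL ⇒ KERNEL-MODE CANCELLATION**: positivity of the completed two-piece form on `s·u ⊕ v` for all `s`,
with `𝔅(u) = 0`, forces `X(u,v) = −π·conj(Φ_v)·L(u)`. [cite: Zhang2022LandauSiegel, Prop 7.1 p.44, (7.2)] -/
theorem kernelModeCancellation_of_null {θ : ℝ} {X : PairFunctional} (h : Null θ X) :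
    KernelModeCancellation θ X := by
  intro u u' v v' hu hv h0
  have key : ∀ s : ℂ, 0 ≤ mainTermForm u u' * ‖s‖ ^ 2
      + 2 * (s * ((π : ℂ) * conj (overhangMass θ v) * tailFunctional u + X u u' v v')).re
      + ((topDiagForm θ v v').re + 2 * (X v v' v v').re) := fun s => by
    have := h u u' v v' s hu hv
    unfold twoPieceMainTerm at this
    linarith
  have := cancellation_of_nonneg key h0
  linear_combination this

/-! ### Part 6 — `RankOneTailCoupling θ` PROVED for every `θ ≥ 1` -/

section RankOneProof

variable {θ : ℝ} {u u' v v' : ℝ → ℂ}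

/-- below `1` the tail of an overhang piece is the constant `Φ_v`. [cite: Zhang2022LandauSiegel, Prop 7.1 p.44, (8.11)–(8.12)] -/
theorem tail_eq_overhangMass (hθ : 1 ≤ θ) (hv : OverhangPiece θ v v') {y : ℝ} (hy : y ≤ 1) :
    ∫ t in y..θ, v t = overhangMass θ v := by
  have i1 : IntervalIntegrable v volume y 1 := by
    refine ((continuousOn_const (c := (0:ℂ))).congr fun t ht => ?_).intervalIntegrable_of_Icc hy
    exact hv.vanish t ht.2
  have i2 : IntervalIntegrable v volume 1 θ :=
    (hv.cont.mono (Icc_subset_Icc_left zero_le_one)).intervalIntegrable_of_Icc hθ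
  have h0 : ∫ t in y..1, v t = 0 := by
    rw [intervalIntegral.integral_congr (g := fun _ => (0:ℂ)) fun t ht => ?_, intervalIntegral.integral_zero]
    rw [uIcc_of_le hy] at ht
    exact hv.vanish t ht.2
  rw [← intervalIntegral.integral_add_adjacent_intervals i1 i2, h0, zero_add, overhangMass]

/-- beyond `1` the tail of an in-class piece vanishes. [cite: Zhang2022LandauSiegel, Prop 7.1 p.44, (8.11)–(8.12)] -/
theorem tail_inClass_eq_zero (hu : InClassPiece u u') {y : ℝ} (hy : 1 ≤ y) (hθ : 1 ≤ θ) :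
    ∫ t in y..θ, u t = 0 := by
  rw [intervalIntegral.integral_congr (g := fun _ => (0:ℂ)) fun t ht => ?_, intervalIntegral.integral_zero]
  rcases le_total y θ with h | h
  · rw [uIcc_of_le h] at ht; exact hu.vanish t (hy.trans ht.1)
  · rw [uIcc_of_ge h] at ht; exact hu.vanish t (hθ.trans ht.1)

/-- one `j`-summand of `M_θ(u,v)`: `∫₀^θ D_j = conj(π²N_jΦ_v)·((u(1) − u(0)) + iπj∫₀¹u)`.
[cite: Zhang2022LandauSiegel, Prop 7.1 p.44, (8.11)–(8.12)] -/
theorem integral_dipoleIntegrandTop_inClass_overhang (hθ : 1 ≤ θ) (hu : InClassPiece u u')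
    (hv : OverhangPiece θ v v') (j : ℕ) :
    ∫ y in (0:ℝ)..θ, dipoleIntegrandTop θ j u u' v v' y
      = conj ((π : ℂ) ^ 2 * ((bN j : ℝ) : ℂ) * overhangMass θ v)
          * ((u 1 - u 0) + I * π * (j : ℂ) * ∫ t in (0:ℝ)..1, u t) := by
  set D := dipoleIntegrandTop θ j u u' v v' with hD
  set c : ℂ := conj ((π : ℂ) ^ 2 * ((bN j : ℝ) : ℂ) * overhangMass θ v) with hc
  have hEq1 : EqOn D (fun y => c * (u' y + I * π * (j : ℂ) * u y)) (uIoo 0 1) := by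
    intro y hy
    rw [uIoo_of_le zero_le_one] at hy
    simp only [hD, dipoleIntegrandTop, hv.vanish' y hy.2, hv.vanish y hy.2.le,
      tail_eq_overhangMass hθ hv hy.2.le, hc]
    ring
  have hEq2 : EqOn D (fun _ => (0:ℂ)) (uIoo 1 θ) := by
    intro y hy
    rw [uIoo_of_le hθ] at hy
    simp only [hD, dipoleIntegrandTop, hu.vanish' y hy.1.le, hu.vanish y hy.1.le]
    ring
  have iu' : IntervalIntegrable u' volume 0 1 := hu.kinked.isH1.intervalIntegrable
  have iu : IntervalIntegrable (fun y => I * π * (j : ℂ) * u y) volume 0 1 :=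
    (hu.kinked.cont.intervalIntegrable_of_Icc zero_le_one).const_mul _
  have i1 : IntervalIntegrable D volume 0 1 := ((iu'.add iu).const_mul c).congr_uIoo hEq1.symm
  have i2 : IntervalIntegrable D volume 1 θ :=
    (intervalIntegrable_const (c := (0:ℂ))).congr_uIoo hEq2.symm
  rw [← intervalIntegral.integral_add_adjacent_intervals i1 i2, intervalIntegral.integral_congr_uIoo hEq1,
    intervalIntegral.integral_congr_uIoo hEq2, intervalIntegral.integral_zero, add_zero,
    intervalIntegral.integral_const_mul, intervalIntegral.integral_add iu' iu,
    intervalIntegral.integral_const_mul, integral_deriv_eq_neg hu.kinked (hu.vanish 1 le_rfl),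
    hu.vanish 1 le_rfl]
  ring

/-- one `j`-summand of `M_θ(v,u)` vanishes. [cite: Zhang2022LandauSiegel, Prop 7.1 p.44, (8.11)–(8.12)] -/
theorem integral_dipoleIntegrandTop_overhang_inClass (hθ : 1 ≤ θ) (hu : InClassPiece u u')
    (hv : OverhangPiece θ v v') (j : ℕ) :
    ∫ y in (0:ℝ)..θ, dipoleIntegrandTop θ j v v' u u' y = 0 := by
  have h01 : 0 ≤ θ := zero_le_one.trans hθ
  rw [intervalIntegral.integral_congr_uIoo (g := fun _ => (0:ℂ)) fun y hy => ?_, intervalIntegral.integral_zero]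
  rw [uIoo_of_le h01] at hy
  change (v' y + I * π * (j : ℂ) * v y)
      * conj (u' y + I * π * ((bS j : ℝ) : ℂ) * u y + (π : ℂ) ^ 2 * ((bN j : ℝ) : ℂ) * ∫ t in y..θ, u t) = 0
  rcases lt_or_ge y 1 with h | h
  · rw [hv.vanish' y h, hv.vanish y h.le]; ring
  · rw [hu.vanish' y h, hu.vanish y h, tail_inClass_eq_zero hu h hθ]; simp

/-- **RANK-ONE TAIL COUPLING holds** for every `θ ≥ 1`: `M_θ(u,v) = π·conj(Φ_v)·L(u)` and `M_θ(v,u) = 0`.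
[cite: Zhang2022LandauSiegel, Prop 7.1 p.44, (8.11)–(8.12)] -/
theorem rankOneTailCoupling_holds (hθ : 1 ≤ θ) : RankOneTailCoupling θ := by
  intro u u' v v' hu hv
  refine ⟨?_, ?_⟩
  · unfold MformTop
    rw [integral_dipoleIntegrandTop_inClass_overhang hθ hu hv 1,
      integral_dipoleIntegrandTop_inClass_overhang hθ hu hv 2,
      integral_dipoleIntegrandTop_inClass_overhang hθ hu hv 3, bN_one, bN_two, bN_three, tailFunctional]
    have hπ : (π : ℂ) ≠ 0 := by exact_mod_cast Real.pi_ne_zero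
    simp only [map_mul, map_pow, Complex.conj_ofReal]
    push_cast
    field_simp
    ring
  · unfold MformTop
    rw [integral_dipoleIntegrandTop_overhang_inClass hθ hu hv 1,
      integral_dipoleIntegrandTop_overhang_inClass hθ hu hv 2,
      integral_dipoleIntegrandTop_overhang_inClass hθ hu hv 3]
    ring

end RankOneProof

/-! ### Part 7 — the tree's witness modes `g⋆`, `φ_θ` are pieces; the cross term `24πΦ` of `Repair.MformTop_wit` -/

section WitnessPieces

variable {θ : ℝ}

/-- `g⋆` (`Repair.gStar`) is an in-class piece. [cite: Zhang2022LandauSiegel, Prop 7.1 p.44, (7.2)] -/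
theorem inClassPiece_gStar : InClassPiece gStar gStar' where
  kinked :=
    { cont := continuous_gStar.continuousOn
      hasDeriv := fun x hx =>
        (((isC1_gCore.hasDeriv x hx).congr_of_eventuallyEq
          (by filter_upwards [Iio_mem_nhds hx.2] with y hy using gStar_of_le hy.le)).hasDerivWithinAt).congr_deriv
          (gStar'_of_lt hx.2).symm
      memLp := by
        refine kinkedProfile_gCore.memLp.ae_eq ?_
        rw [← Measure.restrict_congr_set (Ioo_ae_eq_Ioc (μ := volume))]
        filter_upwards [ae_restrict_mem measurableSet_Ioo] with y hy using (gStar'_of_lt hy.2).symm }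
  vanish := fun y hy => gStar_of_ge hy
  vanish' := fun y hy => gStar'_of_ge hy

/-- `∫₀¹ g⋆ = 2/(πi)`. [cite: Zhang2022LandauSiegel, Prop 7.1 p.44, (7.2)] -/
theorem integral_gStar : ∫ t in (0:ℝ)..1, gStar t = 2 / ((π : ℂ) * I) := by
  rw [← integral_gCore]
  exact intervalIntegral.integral_congr fun t ht => by
    rw [uIcc_of_le zero_le_one] at ht
    exact gStar_of_le ht.2

/-- the kernel mode's tail functional: `L(g⋆) = 12(0 − 2) + 24πi·2/(πi) = 24`. [cite: Zhang2022LandauSiegel, Prop 7.1 p.44, (7.2)] -/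
theorem tailFunctional_gStar : tailFunctional gStar = 24 := by
  rw [tailFunctional, integral_gStar, gStar_of_ge le_rfl, gStar_of_le zero_le_one, gCore_zero]
  have hπ : (π : ℂ) ≠ 0 := by exact_mod_cast Real.pi_ne_zero
  have hI : (I : ℂ) ≠ 0 := Complex.I_ne_zero
  field_simp
  ring

/-- `φ_θ` (`Repair.phiT θ`) is an overhang piece for `θ ≥ 1`. [cite: Zhang2022LandauSiegel, Prop 7.1 p.44, (7.2)] -/
theorem overhangPiece_phiT (hθ : 1 ≤ θ) : OverhangPiece θ (phiT θ) (phiT' θ) where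
  cont := (continuous_phiT θ).continuousOn
  hasDeriv := by
    intro x hx
    have h := (oneSidedProfile_wit hθ 0).hasDeriv x ⟨zero_lt_one.trans_le hx.1, hx.2⟩
    have e1 : wit θ 0 = phiT θ := by funext y; simp [wit]
    have e2 : wit' θ 0 x = phiT' θ x := by simp [wit']
    rw [e1, e2] at h
    exact h
  memLp := by
    have hc : Continuous fun y : ℝ => (((θ + 1 - 2 * y : ℝ)) : ℂ) := by fun_prop
    have hmem : MemLp (fun y : ℝ => (((θ + 1 - 2 * y : ℝ)) : ℂ)) 2 (volume.restrict (Ioc 1 θ)) := by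
      refine MemLp.of_bound hc.aestronglyMeasurable (|θ + 1| + 2 * |θ|) ?_
      filter_upwards [ae_restrict_mem measurableSet_Ioc] with y hy
      rw [Complex.norm_real, Real.norm_eq_abs]
      have hy' : |y| ≤ |θ| := by
        rw [abs_of_pos (zero_lt_one.trans hy.1)]
        exact hy.2.trans (le_abs_self θ)
      calc |θ + 1 - 2 * y| ≤ |θ + 1| + |2 * y| := abs_sub _ _
        _ = |θ + 1| + 2 * |y| := by rw [abs_mul, abs_two]
        _ ≤ |θ + 1| + 2 * |θ| := by linarith
    refine hmem.ae_eq ?_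
    filter_upwards [ae_restrict_mem measurableSet_Ioc] with y hy
    exact (phiT'_of_ge hy.1.le).symm
  vanish := fun y hy => phiT_of_le hy
  vanish' := fun y hy => phiT'_of_lt hy
  top := by rw [phiT_of_ge hθ]; simp

/-- `Φ(φ_θ) = (θ−1)³/6 = Repair.phiInt θ`. [cite: Zhang2022LandauSiegel, Prop 7.1 p.44, (7.2)] -/
theorem overhangMass_phiT (hθ : 1 ≤ θ) : overhangMass θ (phiT θ) = ((phiInt θ : ℝ) : ℂ) := integral_phiT hθ

/-- **Consistency with the tree's witness** (`Repair.MformTop_wit`: `M_θ(s·g⋆ + φ_θ) = 24sπΦ + (3/π)J₁ + 40πΦJ₀`):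
the cross terms are `M_θ(g⋆, φ_θ) = 24πΦ(θ)` and `M_θ(φ_θ, g⋆) = 0`, instances of `rankOneTailCoupling_holds`.
[cite: Zhang2022LandauSiegel, Prop 7.1 p.44, (7.2)] -/
theorem MformTop_gStar_phiT (hθ : 1 ≤ θ) :
    MformTop θ gStar gStar' (phiT θ) (phiT' θ) = 24 * (π : ℂ) * ((phiInt θ : ℝ) : ℂ)
    ∧ MformTop θ (phiT θ) (phiT' θ) gStar gStar' = 0 := by
  obtain ⟨h1, h2⟩ := rankOneTailCoupling_holds hθ gStar gStar' (phiT θ) (phiT' θ) inClassPiece_gStar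
    (overhangPiece_phiT hθ)
  refine ⟨?_, h2⟩
  rw [h1, overhangMass_phiT hθ, tailFunctional_gStar, Complex.conj_ofReal]
  ring

end WitnessPieces

/-! ### Part 8 — INVISIBLE OVERHANG (hypothesis shape; cf. `KnifeEdgeInvisibleTail`) and its proved consequences -/

section Invisible

variable {θ : ℝ} {X : PairFunctional} {u u' v v' : ℝ → ℂ}

/-- **INVISIBLE OVERHANG (hypothesis shape, NOT asserted):** on every smooth two-piece design the cross main term
is exactly `−π·conj(Φ_v)·L(u)` and the overhang block nets to zero — the form taken by the true off-diagonal input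
when a smooth piece supported on `n ∈ [P^{1+ε}, P^θ]` has `o(1)` twisted sums (complete character sums to modulus
`pD = P^{1+o(1)}`, Pólya–Vinogradov; BPRZ20-type technology). [cite: Zhang2022LandauSiegel, §7 (7.2) p.44] -/
def InvisibleOverhang (θ : ℝ) (X : PairFunctional) : Prop :=
  ∀ u u' v v' : ℝ → ℂ, InClassPiece u u' → OverhangPiece θ v v' →
    X u u' v v' = -((π : ℂ) * conj (overhangMass θ v) * tailFunctional u)
    ∧ (topDiagForm θ v v').re + 2 * (X v v' v v').re = 0

/-- under invisibility the two-piece constant is `|s|²𝔅(u)`. [cite: Zhang2022LandauSiegel, Prop 7.1 p.44, (7.2)] -/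
theorem twoPieceMainTerm_of_invisible (h : InvisibleOverhang θ X) (hu : InClassPiece u u')
    (hv : OverhangPiece θ v v') (s : ℂ) : twoPieceMainTerm θ X u u' v v' s = ‖s‖ ^ 2 * mainTermForm u u' := by
  obtain ⟨h1, h2⟩ := h u u' v v' hu hv
  unfold twoPieceMainTerm
  rw [h1, add_neg_cancel, mul_zero, Complex.zero_re, mul_zero, add_zero]
  linarith

/-- hence the NULL holds (`𝔅(u) ≥ 0`: `mainTermForm_nonneg_of_isH1`). [cite: Zhang2022LandauSiegel, Prop 7.1 p.44, (7.2)] -/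
theorem null_of_invisible (h : InvisibleOverhang θ X) : Null θ X := by
  intro u u' v v' s hu hv
  rw [twoPieceMainTerm_of_invisible h hu hv]
  exact mul_nonneg (by positivity) (mainTermForm_nonneg_of_isH1 hu.kinked.isH1)

/-- … and no two-piece design closes by positivity in such an `X`-world. [cite: Zhang2022LandauSiegel, Prop 7.1 p.44, (7.2)] -/
theorem not_closes_of_invisible (h : InvisibleOverhang θ X) : ¬ ClosesByPositivity θ X := by
  rintro ⟨u, u', v, v', s, hu, hv, hneg⟩
  exact not_lt.2 (null_of_invisible h u u' v v' s hu hv) hneg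

/-- invisibility contains the kernel-mode cancellation (for ALL in-class `u`). [cite: Zhang2022LandauSiegel, Prop 7.1 p.44, (7.2)] -/
theorem kernelModeCancellation_of_invisible (h : InvisibleOverhang θ X) : KernelModeCancellation θ X :=
  fun u u' v v' hu hv _ => (h u u' v v' hu hv).1

/-- … and the completed Cauchy–Schwarz, with equality `0 ≤ 𝔅(u)·0`. [cite: Zhang2022LandauSiegel, Prop 7.1 p.44, (7.2)] -/
theorem completedCS_of_invisible (h : InvisibleOverhang θ X) : CompletedCS θ X := by
  intro u u' v v' hu hv
  obtain ⟨h1, h2⟩ := h u u' v v' hu hv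
  rw [h1, add_neg_cancel, norm_zero, h2, mul_zero]
  norm_num

end Invisible

end KnifeEdge

end Literature.NumberTheory.LFunctions.Zhang2022
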